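import Summits.RiemannHypothesis.RiemannHypothesis.Theorems.ZetaScrewCuspExpansion
import HarnessLib

/-!
# RH-FREE: the top second-difference law of Suzuki's screw function, `M·Δ²Ψ_top = log 2 + O(1/M)`

For `M ≥ 8`,

  `|M·(Ψ(log(M/(M−1))) + Ψ(log((M−1)/(M−2))) − Ψ(log(M/(M−2)))) − log 2| ≤ 70/M`
  (`abs_topSecondDiff_mul_sub_log_two_le`; `∃ C` form `psiDefTopLaw` = sos-theory's sketch `PsiDefTopLaw`,
  `HOME/sos/lean/CuspSketch.lean`, ADDENDUM B §B1 of the screw column's P3 theory).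

`Ψ = zetaScrew` (Suzuki2023 (1.1)); the three arguments are the top two lattice gaps
`a = log(M/(M−1)) ≤ b = log((M−1)/(M−2))` and their sum `log(M/(M−2)) = a + b`, all in `(0, 1/2]`.
By the cusp expansion `Ψ(t) = (t/2)log(1/t) + c·t + O(t²)` (`ZetaScrewCuspExpansion.abs_zetaScrew_sub_cusp_le`,
remainder `≤ 6t²`, `c = (1 − γ₀ − log 2π)/2`) the linear terms cancel in the second difference, the three
remainders are `≤ 36·b² = O(1/M²)`, and the main terms leave
`(1/2)(a·log((a+b)/a) + b·log((a+b)/b)) = ((a+b)/2)·log 2 + O((b−a))`, `b − a = O(1/M²)`,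
`(a+b)·M/2 = 1 + O(1/M)` (`mul_log_add_sub_log_bounds`, `log_div_sub_one_mem`).  Elementary
(`1 − 1/x ≤ log x ≤ x − 1`); the constant `70` is generous.

RH-FREE: a statement about the explicit archimedean part of Suzuki2023 (1.1) near `0`.  Nothing here
bears on the truth of RH.  References: M. Suzuki, J. Lond. Math. Soc. (2) 108 (2023) [Suzuki2023]; [folklore].
-/

set_option linter.dupNamespace false
set_option autoImplicit false

noncomputable section

open Real Set

namespace Summit.RiemannHypothesis.RiemannHypothesis.Theorems.IntegerScrew

open Literature.NumberTheory.LFunctions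

/-! ## The top second-difference law `M·Δ²Ψ_top → log 2` -/

/-- Elementary bracket `1/m ≤ log(m/(m−1)) ≤ 1/(m−1)` for `m > 1`. [folklore] -/
theorem log_div_sub_one_mem {m : ℝ} (hm : 1 < m) :
    1 / m ≤ Real.log (m / (m - 1)) ∧ Real.log (m / (m - 1)) ≤ 1 / (m - 1) := by
  have hm0 : 0 < m := by linarith
  have hm1 : 0 < m - 1 := by linarith
  have hx : 0 < m / (m - 1) := by positivity
  constructor
  · have h := Real.one_sub_inv_le_log_of_pos hx
    rw [inv_div] at h
    have e : 1 - (m - 1) / m = 1 / m := by field_simp; ring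
    linarith
  · have h := Real.log_le_sub_one_of_pos hx
    have e : m / (m - 1) - 1 = 1 / (m - 1) := by field_simp; ring
    linarith

/-- The entropy-type second difference of the main term: for `0 < a ≤ b`,
`0 ≤ a·(log(a+b) − log a − log 2) ≤ (b − a)/2` and `−(b − a) ≤ b·(log(a+b) − log b − log 2) ≤ 0`. [folklore] -/
theorem mul_log_add_sub_log_bounds {a b : ℝ} (ha : 0 < a) (hab : a ≤ b) :
    (0 ≤ a * (Real.log (a + b) - Real.log a - Real.log 2)
      ∧ a * (Real.log (a + b) - Real.log a - Real.log 2) ≤ (b - a) / 2)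
    ∧ (b * (Real.log (a + b) - Real.log b - Real.log 2) ≤ 0
      ∧ -(b - a) ≤ b * (Real.log (a + b) - Real.log b - Real.log 2)) := by
  have hb : 0 < b := lt_of_lt_of_le ha hab
  have hab0 : 0 < a + b := by linarith
  have hxa : 0 < (a + b) / (2 * a) := by positivity
  have hxb : 0 < (a + b) / (2 * b) := by positivity
  have hla : Real.log ((a + b) / (2 * a)) = Real.log (a + b) - Real.log a - Real.log 2 := by
    rw [Real.log_div hab0.ne' (by positivity), Real.log_mul (by norm_num) ha.ne']; ring
  have hlb : Real.log ((a + b) / (2 * b)) = Real.log (a + b) - Real.log b - Real.log 2 := by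
    rw [Real.log_div hab0.ne' (by positivity), Real.log_mul (by norm_num) hb.ne']; ring
  rw [← hla, ← hlb]
  refine ⟨⟨?_, ?_⟩, ⟨?_, ?_⟩⟩
  · exact mul_nonneg ha.le (Real.log_nonneg ((one_le_div (by positivity)).mpr (by linarith)))
  · have h := Real.log_le_sub_one_of_pos hxa
    have e : a * ((a + b) / (2 * a) - 1) = (b - a) / 2 := by field_simp; ring
    calc a * Real.log ((a + b) / (2 * a)) ≤ a * ((a + b) / (2 * a) - 1) :=
          mul_le_mul_of_nonneg_left h ha.le
      _ = (b - a) / 2 := e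
  · have h : Real.log ((a + b) / (2 * b)) ≤ 0 :=
      Real.log_nonpos hxb.le ((div_le_one (by positivity)).mpr (by linarith))
    exact mul_nonpos_of_nonneg_of_nonpos hb.le h
  · have h := Real.one_sub_inv_le_log_of_pos hxb
    rw [inv_div] at h
    have e : b * (1 - 2 * b / (a + b)) + (b - a) = (b - a) * a / (a + b) := by
      field_simp; ring
    have hpos : 0 ≤ (b - a) * a / (a + b) := div_nonneg (mul_nonneg (by linarith) ha.le) hab0.le
    have h2 : b * (1 - 2 * b / (a + b)) ≤ b * Real.log ((a + b) / (2 * b)) :=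
      mul_le_mul_of_nonneg_left h hb.le
    linarith

set_option maxHeartbeats 400000 in
/-- **Top second-difference law (RH-free, explicit).** For `M ≥ 8`,
`|M·(Ψ(log(M/(M−1))) + Ψ(log((M−1)/(M−2))) − Ψ(log(M/(M−2)))) − log 2| ≤ 70/M`:
with `a = log(M/(M−1)) ≤ b = log((M−1)/(M−2))`, `log(M/(M−2)) = a + b`, the linear terms of the cusp
expansion cancel, the `(t/2)log(1/t)` terms leave `((a+b)/2)·log 2 + O(1/M²)`, and the three `6t²`
remainders are `O(1/M²)`. [folklore] -/
theorem abs_topSecondDiff_mul_sub_log_two_le {M : ℕ} (hM : 8 ≤ M) :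
    |(zetaScrew (Real.log ((M : ℝ) / (M - 1))) + zetaScrew (Real.log (((M : ℝ) - 1) / (M - 2)))
        - zetaScrew (Real.log ((M : ℝ) / (M - 2)))) * M - Real.log 2| ≤ 70 / M := by
  set m : ℝ := (M : ℝ) with hm
  have hm8 : (8 : ℝ) ≤ m := by rw [hm]; exact_mod_cast hM
  have hm0 : 0 < m := by linarith
  have hm1 : 0 < m - 1 := by linarith
  have hm2 : 0 < m - 2 := by linarith
  -- the three arguments: `a`, `b`, and `a + b`
  set a := Real.log (m / (m - 1)) with ha
  set b := Real.log ((m - 1) / (m - 2)) with hb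
  have hs : Real.log (m / (m - 2)) = a + b := by
    rw [ha, hb, ← Real.log_mul (by positivity) (by positivity)]
    congr 1
    field_simp
  rw [hs]
  -- elementary sizes, all measured by `e = 1/(m−2)`
  obtain ⟨ha_lo, ha_hi⟩ := log_div_sub_one_mem (m := m) (by linarith)
  obtain ⟨hb_lo, hb_hi⟩ : 1 / (m - 1) ≤ b ∧ b ≤ 1 / (m - 2) := by
    have h := log_div_sub_one_mem (m := m - 1) (by linarith)
    have e2 : m - 1 - 1 = m - 2 := by ring
    rw [e2] at h
    exact h
  set e := 1 / (m - 2) with he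
  have he0 : 0 < e := by positivity
  have he6 : e ≤ 1 / 6 := by
    rw [he, div_le_div_iff₀ hm2 (by norm_num)]; linarith
  have hem : m * e = 1 + 2 * e := by rw [he]; field_simp; ring
  have he_m : e ≤ 4 / (3 * m) := by
    rw [he, div_le_div_iff₀ hm2 (by positivity)]; linarith
  have h1e : 1 / (m - 1) ≤ e := by
    rw [he, div_le_div_iff₀ hm1 hm2]; linarith
  have hab : a ≤ b := le_trans ha_hi hb_lo
  have ha0 : 0 < a := lt_of_lt_of_le (by positivity) ha_lo
  have hb0 : 0 < b := lt_of_lt_of_le ha0 hab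
  have hae : a ≤ e := le_trans ha_hi h1e
  have hbe : b ≤ e := hb_hi
  have hma_lo : 1 ≤ m * a := by
    have h := (div_le_iff₀ hm0).mp ha_lo
    linarith [h]
  have hma_hi : m * a ≤ 1 + e := by
    have h : m * a ≤ m * (1 / (m - 1)) := mul_le_mul_of_nonneg_left ha_hi hm0.le
    have e1 : m * (1 / (m - 1)) = 1 + 1 / (m - 1) := by field_simp; ring
    linarith
  have hmb_lo : 1 ≤ m * b := le_trans hma_lo (mul_le_mul_of_nonneg_left hab hm0.le)
  have hmb_hi : m * b ≤ 1 + 2 * e := by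
    have h : m * b ≤ m * e := mul_le_mul_of_nonneg_left hbe hm0.le
    linarith
  -- the cusp expansion at the three points
  set c := (1 - Real.eulerMascheroniConstant - Real.log (2 * Real.pi)) / 2 with hc
  have hs0 : 0 < a + b := by linarith
  have hs2 : a + b ≤ 1 / 2 := by linarith
  set εa := zetaScrew a - (a / 2 * Real.log (1 / a) + c * a) with hεa
  set εb := zetaScrew b - (b / 2 * Real.log (1 / b) + c * b) with hεb
  set εs := zetaScrew (a + b) - ((a + b) / 2 * Real.log (1 / (a + b)) + c * (a + b)) with hεs
  have ra : |εa| ≤ 6 * a ^ 2 := abs_zetaScrew_sub_cusp_le ha0 (by linarith)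
  have rb : |εb| ≤ 6 * b ^ 2 := abs_zetaScrew_sub_cusp_le hb0 (by linarith)
  have rs : |εs| ≤ 6 * (a + b) ^ 2 := abs_zetaScrew_sub_cusp_le hs0 hs2
  have hza : zetaScrew a = εa - a / 2 * Real.log a + c * a := by
    rw [hεa, one_div, Real.log_inv]; ring
  have hzb : zetaScrew b = εb - b / 2 * Real.log b + c * b := by
    rw [hεb, one_div, Real.log_inv]; ring
  have hzs : zetaScrew (a + b) = εs - (a + b) / 2 * Real.log (a + b) + c * (a + b) := by
    rw [hεs, one_div, Real.log_inv]; ring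
  -- the algebraic decomposition
  have key : (zetaScrew a + zetaScrew b - zetaScrew (a + b)) * m - Real.log 2
      = (m * (a + b) / 2 - 1) * Real.log 2
        + m / 2 * (a * (Real.log (a + b) - Real.log a - Real.log 2)
          + b * (Real.log (a + b) - Real.log b - Real.log 2))
        + m * (εa + εb - εs) := by
    rw [hza, hzb, hzs]; ring
  rw [key]
  obtain ⟨⟨hX1, hX2⟩, ⟨hX3, hX4⟩⟩ := mul_log_add_sub_log_bounds ha0 hab
  set Xa := a * (Real.log (a + b) - Real.log a - Real.log 2) with hXa
  set Xb := b * (Real.log (a + b) - Real.log b - Real.log 2) with hXb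
  have hL0 : 0 < Real.log 2 := Real.log_pos one_lt_two
  have hL1 : Real.log 2 < 7 / 10 := by
    have := Real.log_two_lt_d9; norm_num at this ⊢; linarith
  -- term sizes (linear bookkeeping in the atoms `m*a`, `m*b`, `m*e`)
  have hT1 : 0 ≤ m * (a + b) / 2 - 1 ∧ m * (a + b) / 2 - 1 ≤ 3 / 2 * e := by
    have e1 : m * (a + b) / 2 - 1 = (m * a + m * b) / 2 - 1 := by ring
    rw [e1]
    constructor
    · linarith
    · linarith
  have hT2 : |m / 2 * (Xa + Xb)| ≤ e := by
    have hup : m / 2 * (Xa + Xb) ≤ m / 2 * ((b - a) / 2) :=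
      mul_le_mul_of_nonneg_left (by linarith) (by positivity)
    have hlo : m / 2 * (-(b - a)) ≤ m / 2 * (Xa + Xb) :=
      mul_le_mul_of_nonneg_left (by linarith) (by positivity)
    have e1 : m / 2 * ((b - a) / 2) = (m * b - m * a) / 4 := by ring
    have e2 : m / 2 * (-(b - a)) = -((m * b - m * a) / 2) := by ring
    rw [abs_le]
    constructor
    · linarith
    · linarith
  have hT3 : |m * (εa + εb - εs)| ≤ 48 * e := by
    obtain ⟨ra1, ra2⟩ := abs_le.mp ra
    obtain ⟨rb1, rb2⟩ := abs_le.mp rb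
    obtain ⟨rs1, rs2⟩ := abs_le.mp rs
    have hq : m * (6 * a ^ 2 + 6 * b ^ 2 + 6 * (a + b) ^ 2) ≤ 48 * e := by
      have h1 : a ^ 2 ≤ e ^ 2 := pow_le_pow_left₀ ha0.le hae 2
      have h2 : b ^ 2 ≤ e ^ 2 := pow_le_pow_left₀ hb0.le hbe 2
      have h3 : (a + b) ^ 2 ≤ (2 * e) ^ 2 := pow_le_pow_left₀ hs0.le (by linarith) 2
      have h4 : m * (6 * a ^ 2 + 6 * b ^ 2 + 6 * (a + b) ^ 2) ≤ m * (36 * e ^ 2) :=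
        mul_le_mul_of_nonneg_left (by linarith) hm0.le
      have h5 : m * (36 * e ^ 2) = 36 * (m * e) * e := by ring
      have h6 : 36 * (m * e) * e ≤ 36 * (4 / 3) * e := by
        apply mul_le_mul_of_nonneg_right _ he0.le
        rw [hem]; linarith
      linarith
    have hup : m * (εa + εb - εs) ≤ m * (6 * a ^ 2 + 6 * b ^ 2 + 6 * (a + b) ^ 2) :=
      mul_le_mul_of_nonneg_left (by linarith) hm0.le
    have hlo : m * (-(6 * a ^ 2 + 6 * b ^ 2 + 6 * (a + b) ^ 2)) ≤ m * (εa + εb - εs) :=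
      mul_le_mul_of_nonneg_left (by linarith) hm0.le
    have e1 : m * (-(6 * a ^ 2 + 6 * b ^ 2 + 6 * (a + b) ^ 2))
        = -(m * (6 * a ^ 2 + 6 * b ^ 2 + 6 * (a + b) ^ 2)) := by ring
    rw [abs_le]
    constructor
    · linarith
    · linarith
  -- assemble
  have hsum : |(m * (a + b) / 2 - 1) * Real.log 2 + m / 2 * (Xa + Xb) + m * (εa + εb - εs)|
      ≤ (m * (a + b) / 2 - 1) * Real.log 2 + |m / 2 * (Xa + Xb)| + |m * (εa + εb - εs)| := by
    have e1 := abs_add_le ((m * (a + b) / 2 - 1) * Real.log 2 + m / 2 * (Xa + Xb))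
      (m * (εa + εb - εs))
    have e2 := abs_add_le ((m * (a + b) / 2 - 1) * Real.log 2) (m / 2 * (Xa + Xb))
    have e3 : |(m * (a + b) / 2 - 1) * Real.log 2| = (m * (a + b) / 2 - 1) * Real.log 2 :=
      abs_of_nonneg (mul_nonneg hT1.1 hL0.le)
    linarith
  have hT1' : (m * (a + b) / 2 - 1) * Real.log 2 ≤ 3 / 2 * e * (7 / 10) :=
    mul_le_mul hT1.2 hL1.le hL0.le (by positivity)
  have htot : (m * (a + b) / 2 - 1) * Real.log 2 + |m / 2 * (Xa + Xb)| + |m * (εa + εb - εs)|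
      ≤ 51 * e := by linarith
  have h51 : 51 * e ≤ 70 / m := by
    have h1 : 51 * e ≤ 51 * (4 / (3 * m)) := by linarith
    have e2 : 51 * (4 / (3 * m)) = 68 / m := by field_simp; ring
    have e3 : 68 / m ≤ 70 / m := div_le_div_of_nonneg_right (by norm_num) hm0.le
    linarith
  linarith

/-- The top law in the `∃ C` form of sos-theory's sketch `PsiDefTopLaw` (`HOME/sos/lean/CuspSketch.lean`,
ADDENDUM B §B1), verbatim. [folklore] -/
theorem psiDefTopLaw :
    ∃ C : ℝ, ∀ M : ℕ, 8 ≤ M →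
      |(zetaScrew (Real.log ((M : ℝ) / (M - 1))) + zetaScrew (Real.log (((M : ℝ) - 1) / (M - 2)))
          - zetaScrew (Real.log ((M : ℝ) / (M - 2)))) * M - Real.log 2| ≤ C / M :=
  ⟨70, fun _ hM => abs_topSecondDiff_mul_sub_log_two_le hM⟩

end Summit.RiemannHypothesis.RiemannHypothesis.Theorems.IntegerScrew

end
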